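import Summits.Ventures.HodgeRepro2.T5SU11LegendreZeros
import Summits.Ventures.HodgeRepro2.T5SU11LegendreTuran

/-!
# The zeros of `P_n` and `P_{n+1}` interlace: `r_1 < s_1 < r_2 < s_2 < … < s_n < r_{n+1}`

Row 400 (`T5SU11LegendreZeros`) gave the `n` simple zeros of `P_n` in `(−1, 1)`. Here the classical INTERLACING:
between two consecutive zeros `a < b` of `P_{n+1}` lies a zero of `P_n` (`exists_root_legP_between`), hence, with the
increasing enumerations `r : Fin (n+1) → ℝ` of the zeros of `P_{n+1}` and `s : Fin n → ℝ` of the zeros of `P_n`,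

  **`r (i) < s (i) < r (i + 1)` for every `i < n`**   (`interlacing`),

and between two zeros of `P_n` there is a zero of `P_{n+1}` (`exists_root_legP_succ_between`). The proof: the confluent
Christoffel–Darboux formula of row 382 gives `W(x) := P_n(x) P'_{n+1}(x) − P_{n+1}(x) P'_n(x) ≥ 1/(n+1) > 0` for EVERY
real `x` (`legP_mul_legQ_succ_sub_pos'`, the `k = 0` term of the sum is `1`), so at a zero `a` of `P_{n+1}` the signs of
`P_n(a)` and `P'_{n+1}(a)` agree; at two consecutive simple zeros `a < b` of `P_{n+1}` the derivative changes sign —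
`P'_{n+1}(a) · P'_{n+1}(b) < 0` (`eval_derivative_mul_eval_derivative_neg`), because `P_{n+1} = (X − a) q` with
`q(a) = P'_{n+1}(a) ≠ 0` (simplicity) and `q ≠ 0` on `[a, b)`, so `P'_{n+1}(a)` has the sign of `P_{n+1}` on `(a, b)`,
while `P'_{n+1}(b)` has the opposite one — and the intermediate value theorem does the rest. Nothing is claimed
about (N).

Blind lane: Mathlib + the HodgeRepro2 prefix only; no sorry; axioms ⊆ {propext, Classical.choice,
Quot.sound}.
-/

namespace Summit.Ventures.HodgeRepro2.T5SU11LegendreInterlacing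

open Polynomial Set Finset
open T5SU11SphericalLegendreAll T5SU11SphericalLegendreLaplace T5SU11LegendreIdentities T5SU11JacobiPhaseLawEven
  T5SU11JacobiLegendreLeading T5SU11LegendreZeros T5SU11LegendreTuran

/-! ### Sign tools: the intermediate value theorem for polynomials -/

/-- **A polynomial with values of opposite signs at `u < v` has a zero in `(u, v)`.** -/
theorem exists_root_of_mul_neg (p : ℝ[X]) {u v : ℝ} (huv : u ≤ v) (h : p.eval u * p.eval v < 0) :
    ∃ c ∈ Ioo u v, p.eval c = 0 := by
  rcases lt_or_gt_of_ne (show p.eval u ≠ 0 from fun h0 => by rw [h0, zero_mul] at h; exact lt_irrefl _ h) with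
    hu | hu
  · have hv : 0 < p.eval v := by
      by_contra hv
      push Not at hv
      exact absurd h (not_lt.mpr (mul_nonneg_of_nonpos_of_nonpos hu.le hv))
    obtain ⟨c, hc, hc0⟩ := intermediate_value_Ioo huv p.continuousOn ⟨hu, hv⟩
    exact ⟨c, hc, hc0⟩
  · have hv : p.eval v < 0 := by
      by_contra hv
      push Not at hv
      exact absurd h (not_lt.mpr (mul_nonneg hu.le hv))
    obtain ⟨c, hc, hc0⟩ := intermediate_value_Ioo' huv p.continuousOn ⟨hv, hu⟩
    exact ⟨c, hc, hc0⟩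

/-- **Constant sign on `[a, b)` without zeros**: if `p(a) ≠ 0` and `p ≠ 0` on `(a, b)`, then `p(a) p(x) > 0` on `(a, b)`. -/
theorem eval_mul_eval_pos_of_forall_ne (p : ℝ[X]) {a b : ℝ} (ha : p.eval a ≠ 0) (hno : ∀ x ∈ Ioo a b, p.eval x ≠ 0)
    {x : ℝ} (hx : x ∈ Ioo a b) : 0 < p.eval a * p.eval x := by
  by_contra hle
  push Not at hle
  have hlt : p.eval a * p.eval x < 0 := lt_of_le_of_ne hle (mul_ne_zero ha (hno x hx))
  obtain ⟨c, hc, hc0⟩ := exists_root_of_mul_neg p hx.1.le hlt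
  exact hno c ⟨hc.1, hc.2.trans hx.2⟩ hc0

/-- **Constant sign on `(a, b]` without zeros**: if `p(b) ≠ 0` and `p ≠ 0` on `(a, b)`, then `p(x) p(b) > 0` on `(a, b)`. -/
theorem eval_mul_eval_pos_of_forall_ne' (p : ℝ[X]) {a b : ℝ} (hb : p.eval b ≠ 0) (hno : ∀ x ∈ Ioo a b, p.eval x ≠ 0)
    {x : ℝ} (hx : x ∈ Ioo a b) : 0 < p.eval x * p.eval b := by
  by_contra hle
  push Not at hle
  have hlt : p.eval x * p.eval b < 0 := lt_of_le_of_ne hle (mul_ne_zero (hno x hx) hb)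
  obtain ⟨c, hc, hc0⟩ := exists_root_of_mul_neg p hx.2.le hlt
  exact hno c ⟨hx.1.trans hc.1, hc.2⟩ hc0

/-! ### The derivative changes sign between consecutive simple zeros -/

/-- **The derivative at a simple zero is the cofactor**: if `p(a) = 0` then `p = (X − a) q` with `q(a) = p'(a)`, and
`q(a) ≠ 0` when `a` is a simple root. -/
theorem exists_cofactor (p : ℝ[X]) {a : ℝ} (ha : p.eval a = 0) (hp : p ≠ 0) (hsimple : rootMultiplicity a p = 1) :
    ∃ q : ℝ[X], p = (X - C a) * q ∧ q.eval a = (derivative p).eval a ∧ q.eval a ≠ 0 := by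
  have hfac : (X - C a) * (p /ₘ (X - C a)) = p := mul_divByMonic_eq_iff_isRoot.mpr ha
  refine ⟨p /ₘ (X - C a), hfac.symm, ?_, ?_⟩
  · conv_rhs => rw [← hfac]
    rw [derivative_mul, derivative_sub, derivative_X, derivative_C, sub_zero, one_mul, eval_add, eval_mul,
      eval_sub, eval_X, eval_C, sub_self, zero_mul, add_zero]
  · intro hq
    have hdvd : X - C a ∣ p /ₘ (X - C a) := dvd_iff_isRoot.mpr hq
    have h2 : (X - C a) ^ 2 ∣ p := by
      rw [← hfac, pow_two]
      exact mul_dvd_mul_left _ hdvd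
    have := (le_rootMultiplicity_iff hp).mpr h2
    omega

/-- **`p'(a) · p'(b) < 0` at consecutive simple zeros `a < b` of `p`.** -/
theorem eval_derivative_mul_eval_derivative_neg (p : ℝ[X]) (hp : p ≠ 0) {a b : ℝ} (hab : a < b)
    (ha : p.eval a = 0) (hb : p.eval b = 0) (hsa : rootMultiplicity a p = 1) (hsb : rootMultiplicity b p = 1)
    (hno : ∀ x ∈ Ioo a b, p.eval x ≠ 0) :
    (derivative p).eval a * (derivative p).eval b < 0 := by
  obtain ⟨q, hq, hqa, hqa0⟩ := exists_cofactor p ha hp hsa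
  obtain ⟨q', hq', hqb, hqb0⟩ := exists_cofactor p hb hp hsb
  -- a point of `(a, b)`
  set x := (a + b) / 2 with hx
  have hxab : x ∈ Ioo a b := ⟨by rw [hx]; linarith, by rw [hx]; linarith⟩
  have hpx : p.eval x ≠ 0 := hno x hxab
  -- `q ≠ 0` on `(a, b)` and `q' ≠ 0` on `(a, b)`
  have hqno : ∀ y ∈ Ioo a b, q.eval y ≠ 0 := fun y hy hy0 => by
    apply hno y hy
    rw [hq, eval_mul, hy0, mul_zero]
  have hq'no : ∀ y ∈ Ioo a b, q'.eval y ≠ 0 := fun y hy hy0 => by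
    apply hno y hy
    rw [hq', eval_mul, hy0, mul_zero]
  have h1 := eval_mul_eval_pos_of_forall_ne q hqa0 hqno hxab
  have h2 := eval_mul_eval_pos_of_forall_ne' q' hqb0 hq'no hxab
  -- `p(x) = (x − a) q(x) = (x − b) q'(x)`
  have e1 : p.eval x = (x - a) * q.eval x := by rw [hq, eval_mul, eval_sub, eval_X, eval_C]
  have e2 : p.eval x = (x - b) * q'.eval x := by rw [hq', eval_mul, eval_sub, eval_X, eval_C]
  rw [← hqa, ← hqb]
  -- `q(a) p(x) > 0` and `q'(b) p(x) < 0`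
  have h3 : 0 < q.eval a * p.eval x := by
    rw [e1, show q.eval a * ((x - a) * q.eval x) = (x - a) * (q.eval a * q.eval x) by ring]
    exact mul_pos (by linarith [hxab.1]) h1
  have h4 : q'.eval b * p.eval x < 0 := by
    rw [e2, show q'.eval b * ((x - b) * q'.eval x) = (x - b) * (q'.eval x * q'.eval b) by ring]
    exact mul_neg_of_neg_of_pos (by linarith [hxab.2]) h2
  have h5 : (q.eval a * p.eval x) * (q'.eval b * p.eval x) < 0 := mul_neg_of_pos_of_neg h3 h4
  have h6 : (q.eval a * p.eval x) * (q'.eval b * p.eval x) = (q.eval a * q'.eval b) * p.eval x ^ 2 := by ring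
  rw [h6] at h5
  have hsq : 0 < p.eval x ^ 2 := by positivity
  exact neg_of_mul_neg_left h5 hsq.le

/-! ### The Christoffel–Darboux positivity on the whole line -/

/-- **`P_n(x) P'_{n+1}(x) − P_{n+1}(x) P'_n(x) > 0` for EVERY real `x`** (the `k = 0` term of the confluent
Christoffel–Darboux sum is `1`). -/
theorem legP_mul_legQ_succ_sub_pos' (n : ℕ) (x : ℝ) :
    0 < legP n x * legQ (n + 1) x - legP (n + 1) x * legQ n x := by
  have h := christoffel_darboux_confluent n x
  have hpos : 0 < ∑ k ∈ range (n + 1), (2 * (k : ℝ) + 1) * legP k x ^ 2 := by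
    refine lt_of_lt_of_le (by norm_num : (0 : ℝ) < 1) ?_
    calc (1 : ℝ) = (2 * ((0 : ℕ) : ℝ) + 1) * legP 0 x ^ 2 := by simp
      _ ≤ ∑ k ∈ range (n + 1), (2 * (k : ℝ) + 1) * legP k x ^ 2 :=
        Finset.single_le_sum (f := fun k : ℕ => (2 * (k : ℝ) + 1) * legP k x ^ 2)
          (fun k _ => by positivity) (Finset.mem_range.mpr (Nat.succ_pos n))
  have hn : (0 : ℝ) < (n : ℝ) + 1 := by positivity
  rw [h] at hpos
  exact pos_of_mul_pos_right hpos hn.le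

/-! ### A zero of `P_n` between consecutive zeros of `P_{n+1}` -/

/-- **Between two consecutive zeros of `P_{n+1}` lies a zero of `P_n`.** -/
theorem exists_root_legP_between (n : ℕ) {a b : ℝ} (hab : a < b) (ha : legP (n + 1) a = 0) (hb : legP (n + 1) b = 0)
    (hno : ∀ x ∈ Ioo a b, legP (n + 1) x ≠ 0) : ∃ c ∈ Ioo a b, legP n c = 0 := by
  obtain ⟨s, hcard, hs, hiff, hsimple⟩ := legendre_zeros (n + 1)
  have hsa : rootMultiplicity a (legPoly (n + 1)) = 1 := hsimple a ((hiff a).mp ha)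
  have hsb : rootMultiplicity b (legPoly (n + 1)) = 1 := hsimple b ((hiff b).mp hb)
  have hno' : ∀ x ∈ Ioo a b, (legPoly (n + 1)).eval x ≠ 0 := fun x hx => by
    rw [← legP_eq_eval]; exact hno x hx
  have hder := eval_derivative_mul_eval_derivative_neg (legPoly (n + 1)) (legPoly_ne_zero _) hab
    ((legP_eq_eval _ _).symm.trans ha) ((legP_eq_eval _ _).symm.trans hb) hsa hsb hno'
  rw [eval_derivative_legPoly, eval_derivative_legPoly] at hder
  -- `W(a) = P_n(a) P'_{n+1}(a) > 0`, `W(b) = P_n(b) P'_{n+1}(b) > 0`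
  have hWa := legP_mul_legQ_succ_sub_pos' n a
  have hWb := legP_mul_legQ_succ_sub_pos' n b
  rw [ha, zero_mul, sub_zero] at hWa
  rw [hb, zero_mul, sub_zero] at hWb
  -- hence `P_n(a) P_n(b) < 0`
  have hprod : (legP n a * legQ (n + 1) a) * (legP n b * legQ (n + 1) b) > 0 := mul_pos hWa hWb
  have e : (legP n a * legQ (n + 1) a) * (legP n b * legQ (n + 1) b)
      = (legP n a * legP n b) * (legQ (n + 1) a * legQ (n + 1) b) := by ring
  rw [e] at hprod
  have hneg : legP n a * legP n b < 0 := by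
    by_contra hle
    push Not at hle
    exact absurd hprod (not_lt.mpr (mul_nonpos_of_nonneg_of_nonpos hle hder.le))
  obtain ⟨c, hc, hc0⟩ := exists_root_of_mul_neg (legPoly n) hab.le
    (by rwa [← legP_eq_eval, ← legP_eq_eval])
  exact ⟨c, hc, (legP_eq_eval n c).trans hc0⟩

/-! ### The interlacing theorem -/

/-- **THE ZEROS OF `P_n` AND `P_{n+1}` INTERLACE**: there are increasing enumerations `r : Fin (n+1) → ℝ` of the zeros
of `P_{n+1}` and `s : Fin n → ℝ` of the zeros of `P_n` with `r i < s i < r (i+1)` for every `i < n`. -/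
theorem interlacing (n : ℕ) :
    ∃ (r : Fin (n + 1) → ℝ) (s : Fin n → ℝ), StrictMono r ∧ StrictMono s
      ∧ (∀ x, legP (n + 1) x = 0 ↔ ∃ i, r i = x) ∧ (∀ x, legP n x = 0 ↔ ∃ i, s i = x)
      ∧ ∀ i : Fin n, r (Fin.castSucc i) < s i ∧ s i < r i.succ := by
  obtain ⟨t, htcard, -, htiff, -⟩ := legendre_zeros (n + 1)
  obtain ⟨u, hucard, -, huiff, -⟩ := legendre_zeros n
  let e : Fin (n + 1) ↪o ℝ := t.orderEmbOfFin htcard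
  have he : ∀ i, e i ∈ t := fun i => Finset.orderEmbOfFin_mem t htcard i
  have hrange : ∀ x, x ∈ t ↔ ∃ i, e i = x := fun x => by
    rw [← Finset.mem_coe, ← Finset.range_orderEmbOfFin t htcard]
    rfl
  -- consecutive zeros of `P_{n+1}`: nothing of `t` lies strictly between `e (castSucc i)` and `e i.succ`
  have hgap : ∀ i : Fin n, ∀ x ∈ Ioo (e (Fin.castSucc i)) (e i.succ), legP (n + 1) x ≠ 0 := by
    intro i x hx hx0
    obtain ⟨j, hj⟩ := (hrange x).mp ((htiff x).mp hx0)
    rw [← hj] at hx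
    have h1 : Fin.castSucc i < j := e.strictMono.lt_iff_lt.mp hx.1
    have h2 : j < i.succ := e.strictMono.lt_iff_lt.mp hx.2
    rw [Fin.lt_def] at h1 h2
    simp only [Fin.val_castSucc, Fin.val_succ] at h1 h2
    omega
  have hroll : ∀ i : Fin n, ∃ c ∈ Ioo (e (Fin.castSucc i)) (e i.succ), legP n c = 0 := fun i =>
    exists_root_legP_between n (e.strictMono Fin.castSucc_lt_succ)
      ((htiff _).mpr (he _)) ((htiff _).mpr (he _)) (hgap i)
  choose c hc hc0 using hroll
  have hcmono : StrictMono c := by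
    intro i j hij
    have h1 : i.succ ≤ Fin.castSucc j := by
      rw [Fin.le_def]
      simp only [Fin.val_succ, Fin.val_castSucc]
      rw [Fin.lt_def] at hij
      omega
    calc c i < e i.succ := (hc i).2
      _ ≤ e (Fin.castSucc j) := e.strictMono.monotone h1
      _ < c j := (hc j).1
  -- the image of `c` is the whole zero set of `P_n`
  have himage : Finset.univ.image c = u := by
    refine Finset.eq_of_subset_of_card_le ?_ ?_
    · intro x hx
      obtain ⟨i, -, rfl⟩ := Finset.mem_image.mp hx
      exact (huiff _).mp (hc0 i)
    · rw [Finset.card_image_of_injective _ hcmono.injective, Finset.card_univ, Fintype.card_fin, hucard]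
  refine ⟨e, c, e.strictMono, hcmono, fun x => (htiff x).trans (hrange x), ?_, fun i => ⟨(hc i).1, (hc i).2⟩⟩
  intro x
  rw [huiff, ← himage, Finset.mem_image]
  exact ⟨fun ⟨i, _, hi⟩ => ⟨i, hi⟩, fun ⟨i, hi⟩ => ⟨i, Finset.mem_univ _, hi⟩⟩

/-- **Between two zeros of `P_n` lies a zero of `P_{n+1}`**: in the enumerations of `interlacing`, for `i < j` the
zero `r (i + 1)` of `P_{n+1}` lies in `(s i, s j)`. -/
theorem exists_root_legP_succ_between (n : ℕ) {r : Fin (n + 1) → ℝ} {s : Fin n → ℝ} (hr : StrictMono r)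
    (h : ∀ i : Fin n, r (Fin.castSucc i) < s i ∧ s i < r i.succ) {i j : Fin n} (hij : i < j) :
    ∃ k : Fin (n + 1), s i < r k ∧ r k < s j := by
  refine ⟨i.succ, (h i).2, lt_of_le_of_lt ?_ (h j).1⟩
  apply hr.monotone
  rw [Fin.le_iff_val_le_val]
  simp only [Fin.val_succ, Fin.val_castSucc]
  rw [Fin.lt_def] at hij
  omega

end Summit.Ventures.HodgeRepro2.T5SU11LegendreInterlacing
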